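import Mathlib
import Summits.PneNP.PneNP.Theorems.Nc03AvoidResidualCoreReductionLinA

/-!
# Route Nc03AvoidResidualCore, item `ResidualCoreReduction` — the `𝔽₂`-rank certificates, II: exactly-one

Helper file for `stmt-PneNP-20227` (residual-core reduction of `NC⁰₃-AVOID` at linear stretch; cell
pnp-ideate, dossier HOME/pnp-ideate-p2/ROUND-3.md §2.7). Certificate SOUNDNESS and EXISTENCE for
PURE instances of the NPN class

* `11` (exactly-one; §2.7 "certificate lemma", with a simpler counting than the series-class
  argument there): rows `e_a + e_b + e_c`; if two outputs `f_p, f_q ≠ e⋆` cover two distinct roles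
  of `e⋆` and their rows are spanned by the remaining rows, the pattern "`0` on `f_p, f_q`, `1`
  elsewhere" is never attained (complemented assignments are orthogonal to every row, so `f_p, f_q`
  are all-ones and `e⋆` sees two ones). Exists once `2M > 3N`.

(The `G`-class, `10`, is in the sequel file.) All conditions are span memberships of explicit
vectors — decidable by a rank oracle. Generic tools added here: the leading-term independence
criterion for an injective weight (`linearIndependent_of_triangular`) and the redundancy of non-new
vectors (`span_lt_le_span_new`). [folklore; ROUND-3 §2.7]
-/

set_option linter.dupNamespace false -- `Summit.PneNP.PneNP.…`: summit = sub-problem name (D-0017 single-conjunct layout)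

namespace Summit.PneNP.PneNP.Theorems.Nc03Reduction

open Finset Literature.Computability.Complexity

variable {N M : ℕ}

/-! ## Leading-term criterion with a weight; redundancy of non-new vectors -/

/-- **Leading-term criterion (weighted).** If `w` is injective on `S` and no `u e` (`e ∈ S`) lies in
the span of the `u f`, `f ∈ S`, of smaller weight, the family `(u e)_{e ∈ S}` is linearly
independent. [folklore] -/
theorem linearIndependent_of_triangular {ι : Type*} (S : Finset ι) (u : ι → Vec N) (w : ι → ℕ)
    (hw : Set.InjOn w ↑S)
    (h : ∀ e ∈ S, u e ∉ Submodule.span (ZMod 2) (u '' {f | f ∈ S ∧ w f < w e})) :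
    LinearIndependent (ZMod 2) (fun e : ↥S => u (e : ι)) := by
  classical
  rw [Fintype.linearIndependent_iff]
  intro g hg
  by_contra hne
  push Not at hne
  obtain ⟨i₁, hi₁⟩ := hne
  set T := (Finset.univ : Finset ↥S).filter (fun i => g i ≠ 0) with hT
  have hTne : T.Nonempty := ⟨i₁, by rw [hT, Finset.mem_filter]; exact ⟨Finset.mem_univ _, hi₁⟩⟩
  obtain ⟨i₀, hi₀T, hmax⟩ := Finset.exists_max_image T (fun i => w (i : ι)) hTne
  have hg0 : g i₀ ≠ 0 := (Finset.mem_filter.1 hi₀T).2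
  have hsum : g i₀ • u i₀ + ∑ j ∈ (Finset.univ : Finset ↥S).erase i₀, g j • u j = 0 := by
    rw [Finset.add_sum_erase _ (fun j => g j • u (j : ι)) (Finset.mem_univ i₀)]
    exact hg
  have hui : u i₀ = (-(g i₀)⁻¹) • ∑ j ∈ (Finset.univ : Finset ↥S).erase i₀, g j • u j := by
    have h1 : g i₀ • u (i₀ : ι) = -∑ j ∈ (Finset.univ : Finset ↥S).erase i₀, g j • u j :=
      eq_neg_of_add_eq_zero_left hsum
    calc u (i₀ : ι) = (g i₀)⁻¹ • (g i₀ • u (i₀ : ι)) := by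
          rw [smul_smul, inv_mul_cancel₀ hg0, one_smul]
      _ = _ := by rw [h1, smul_neg, neg_smul]
  apply h i₀ i₀.2
  rw [hui]
  refine Submodule.smul_mem _ _ (Submodule.sum_mem _ fun j hj => ?_)
  by_cases hgj : g j = 0
  · rw [hgj, zero_smul]; exact Submodule.zero_mem _
  · refine Submodule.smul_mem _ _ (Submodule.subset_span ⟨j, ⟨j.2, ?_⟩, rfl⟩)
    have hjT : j ∈ T := by rw [hT, Finset.mem_filter]; exact ⟨Finset.mem_univ _, hgj⟩
    have hle := hmax j hjT
    have hne : (j : ι) ≠ i₀ := fun e => (Finset.mem_erase.1 hj).1 (Subtype.ext e)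
    exact lt_of_le_of_ne hle fun heq => hne (hw j.2 i₀.2 heq)

/-- Non-new vectors are redundant: the span of the `u f'`, `f' < f`, is already spanned by those of
them that are NEW (not in the span of their own predecessors). [folklore] -/
theorem span_lt_le_span_new (u : Fin M → Vec N) (f : Fin M) :
    Submodule.span (ZMod 2) (u '' {f' | f' < f}) ≤
      Submodule.span (ZMod 2)
        (u '' {f' | f' < f ∧ u f' ∉ Submodule.span (ZMod 2) (u '' {g | g < f'})}) := by
  suffices h : ∀ n, ∀ f : Fin M, f.val = n →
      Submodule.span (ZMod 2) (u '' {f' | f' < f}) ≤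
        Submodule.span (ZMod 2)
          (u '' {f' | f' < f ∧ u f' ∉ Submodule.span (ZMod 2) (u '' {g | g < f'})}) from
    h _ f rfl
  intro n
  induction n using Nat.strong_induction_on with
  | _ n ih =>
    intro f hfn
    rw [Submodule.span_le]
    rintro v ⟨f', hf', rfl⟩
    by_cases hnew : u f' ∈ Submodule.span (ZMod 2) (u '' {g | g < f'})
    · have step := ih f'.val (hfn ▸ hf') f' rfl hnew
      refine Submodule.span_mono ?_ step
      rintro w ⟨g, ⟨hg, hgn⟩, rfl⟩
      exact ⟨g, ⟨lt_trans hg hf', hgn⟩, rfl⟩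
    · exact Submodule.subset_span ⟨f', ⟨hf', hnew⟩, rfl⟩

/-! ## Class 11: exactly-one outputs -/

/-- Exactly-one bits have an even number of zeros. -/
theorem rep11_true_imp (a b c : Bool)
    (h : ((a && !b && !c) || (!a && b && !c) || (!a && !b && c)) = true) :
    (xor (xor (!a) (!b)) (!c)) = false := by
  revert a b c h; decide

/-- Bits with an even number of zeros that are not exactly-one are all ones. -/
theorem rep11_false_imp (a b c : Bool)
    (h : ((a && !b && !c) || (!a && b && !c) || (!a && !b && c)) = false)
    (hpar : (xor (xor (!a) (!b)) (!c)) = false) : a = true ∧ b = true ∧ c = true := by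
  revert a b c h hpar; decide

/-- Two ones in distinct roles are not exactly-one. -/
theorem rep11_false_of_two (u : Fin 3 → Bool) (rp rq : Fin 3) (hne : rp ≠ rq) (hp : u rp = true)
    (hq : u rq = true) : rep 11 u = false := by
  revert u rp rq
  simp only [rep]
  decide

/-- Soundness, class `11` (exactly-one). Pattern: `0` on `f_p, f_q`, `1` elsewhere, where
`f_p, f_q ≠ e⋆` read the variables of two distinct roles `r_p ≠ r_q` of `e⋆` and the rows
`e_a+e_b+e_c` of `f_p`, `f_q` lie in the span of the rows of the remaining outputs. Never attained.
[ROUND-3 §2.7, certificate lemma] -/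
theorem cert11_sound {I : LocalMap 3 N M} (hP : I.IsPure (rep 11)) {e fp fq : Fin M} {rp rq : Fin 3}
    (hfpe : fp ≠ e) (hfqe : fq ≠ e) (hr : rp ≠ rq)
    (hcp : I.vars e rp ∈ rd3 I fp) (hcq : I.vars e rq ∈ rd3 I fq)
    (hsp : row7 I fp ∈ Submodule.span (ZMod 2) (row7 I '' {f | f ≠ fp ∧ f ≠ fq}))
    (hsq : row7 I fq ∈ Submodule.span (ZMod 2) (row7 I '' {f | f ≠ fp ∧ f ≠ fq}))
    {y : Fin M → Bool} (hy : ∀ f, y f = false ↔ (f = fp ∨ f = fq)) : y ∉ I.range := by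
  rintro ⟨x, hx⟩
  have horth : ∀ s ∈ row7 I '' {f | f ≠ fp ∧ f ≠ fq}, chi (fun v => !x v) ⬝ᵥ s = 0 := by
    rintro s ⟨f, ⟨h1, h2⟩, rfl⟩
    have hyf : y f = true := by
      cases hyf : y f
      · rcases (hy f).1 hyf with h | h
        · exact absurd h h1
        · exact absurd h h2
      · rfl
    rw [← hx, eval_of_isPure hP] at hyf
    simp only [rep] at hyf
    rw [row7, chi_dot_trip, bit_eq_zero]
    exact rep11_true_imp _ _ _ hyf
  -- `f_p` and `f_q` are all ones
  have hall : ∀ f, (f = fp ∨ f = fq) → row7 I f ∈ Submodule.span (ZMod 2)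
      (row7 I '' {f | f ≠ fp ∧ f ≠ fq}) → ∀ r, x (I.vars f r) = true := by
    intro f hf hspan r
    have h0 := dot_eq_zero_of_mem_span (chi (fun v => !x v)) horth hspan
    rw [row7, chi_dot_trip, bit_eq_zero] at h0
    have hyf : y f = false := (hy f).2 hf
    rw [← hx, eval_of_isPure hP] at hyf
    simp only [rep] at hyf
    have h3 := rep11_false_imp _ _ _ hyf h0
    fin_cases r
    · exact h3.1
    · exact h3.2.1
    · exact h3.2.2
  have hxp : x (I.vars e rp) = true := by
    simp only [rd3, Finset.mem_insert, Finset.mem_singleton] at hcp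
    rcases hcp with h | h | h <;> rw [h] <;> exact hall fp (Or.inl rfl) hsp _
  have hxq : x (I.vars e rq) = true := by
    simp only [rd3, Finset.mem_insert, Finset.mem_singleton] at hcq
    rcases hcq with h | h | h <;> rw [h] <;> exact hall fq (Or.inr rfl) hsq _
  have hye : y e = true := by
    cases hye : y e
    · rcases (hy e).1 hye with h | h
      · exact absurd h.symm hfpe
      · exact absurd h.symm hfqe
    · rfl
  rw [← hx, eval_of_isPure hP] at hye
  rw [rep11_false_of_two (fun i => x (I.vars e i)) rp rq hr hxp hxq] at hye
  exact Bool.noConfusion hye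

open Classical in
/-- The dependent ("non-new") outputs: row in the span of the earlier rows. -/
noncomputable def dep7 (I : LocalMap 3 N M) : Finset (Fin M) :=
  Finset.univ.filter fun f => row7 I f ∈ Submodule.span (ZMod 2) (row7 I '' {f' | f' < f})

/-- Membership in `dep7`. -/
theorem mem_dep7 {I : LocalMap 3 N M} {f : Fin M} :
    f ∈ dep7 I ↔ row7 I f ∈ Submodule.span (ZMod 2) (row7 I '' {f' | f' < f}) := by
  classical
  simp [dep7]

/-- The row of a dependent output is spanned by the rows of all outputs other than itself and
another dependent output. -/
theorem row7_mem_span_of_dep {I : LocalMap 3 N M} {fp fq : Fin M} (hp : fp ∈ dep7 I)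
    (hq : fq ∈ dep7 I) :
    row7 I fp ∈ Submodule.span (ZMod 2) (row7 I '' {f | f ≠ fp ∧ f ≠ fq}) := by
  have hp' := mem_dep7.1 hp
  have step := span_lt_le_span_new (row7 I) fp hp'
  refine Submodule.span_mono ?_ step
  rintro v ⟨f, ⟨-, hfnew⟩, rfl⟩
  refine ⟨f, ⟨?_, ?_⟩, rfl⟩
  · rintro rfl; exact hfnew hp'
  · rintro rfl; exact hfnew (mem_dep7.1 hq)

/-- At least `M - N` outputs are dependent. -/
theorem card_dep7_ge (I : LocalMap 3 N M) : M ≤ (dep7 I).card + N := by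
  classical
  have hnew : ((Finset.univ : Finset (Fin M)).filter fun f => f ∉ dep7 I).card ≤ N := by
    refine card_le_of_triangular _ (row7 I) fun e he hmem => ?_
    have he' := (Finset.mem_filter.1 he).2
    apply he'
    rw [mem_dep7]
    refine Submodule.span_mono ?_ hmem
    rintro v ⟨f, ⟨-, hfe⟩, rfl⟩
    exact ⟨f, hfe, rfl⟩
  have hsplit := Finset.card_filter_add_card_filter_not (s := (Finset.univ : Finset (Fin M)))
    (fun f => f ∈ dep7 I)
  have hfe : (Finset.univ : Finset (Fin M)).filter (fun f => f ∈ dep7 I) = dep7 I := by ext; simp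
  rw [hfe] at hsplit
  simp only [Finset.card_univ, Fintype.card_fin] at hsplit
  omega

/-- Existence, class `11`: with `2M > 3N` the pattern of `cert11_sound` exists (the covering outputs
taken dependent, which gives the span conditions by `row7_mem_span_of_dep`). -/
theorem cert11_exists {I : LocalMap 3 N M} (hP : I.IsPure (rep 11)) (hM : 3 * N < 2 * M) :
    ∃ e fp fq : Fin M, ∃ rp rq : Fin 3, fp ≠ e ∧ fq ≠ e ∧ rp ≠ rq ∧ fp ∈ dep7 I ∧ fq ∈ dep7 I ∧
      I.vars e rp ∈ rd3 I fp ∧ I.vars e rq ∈ rd3 I fq := by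
  classical
  by_contra hno
  push Not at hno
  -- every dependent output has at most one role covered by another dependent output
  let cov : Fin M → Finset (Fin 3) := fun f =>
    Finset.univ.filter fun r => ∃ f' ∈ dep7 I, f' ≠ f ∧ I.vars f r ∈ rd3 I f'
  have hcov : ∀ f ∈ dep7 I, (cov f).card ≤ 1 := by
    intro f _
    rw [Finset.card_le_one]
    intro rp hrp rq hrq
    by_contra hne
    obtain ⟨fp, hfpD, hfpf, hcp⟩ := (Finset.mem_filter.1 hrp).2
    obtain ⟨fq, hfqD, hfqf, hcq⟩ := (Finset.mem_filter.1 hrq).2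
    exact hno f fp fq rp rq hfpf hfqf hne hfpD hfqD hcp hcq
  -- private variables: the uncovered roles, at least two per dependent output, pairwise disjoint
  let priv : Fin M → Finset (Fin N) := fun f => (Finset.univ \ cov f).image fun r => I.vars f r
  have hcard : ∀ f ∈ dep7 I, 2 ≤ (priv f).card := by
    intro f hf
    simp only [priv]
    rw [Finset.card_image_of_injective _ (hP.2 f), Finset.card_sdiff_of_subset (Finset.subset_univ _)]
    simp only [Finset.card_univ, Fintype.card_fin]
    have := hcov f hf
    omega
  have hdisj : (↑(dep7 I) : Set (Fin M)).PairwiseDisjoint priv := by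
    intro f hf f' hf' hne
    rw [Function.onFun, Finset.disjoint_left]
    intro v hv hv'
    simp only [priv, Finset.mem_image, Finset.mem_sdiff, Finset.mem_univ, true_and] at hv hv'
    obtain ⟨r, hr, rfl⟩ := hv
    obtain ⟨r', -, heq⟩ := hv'
    apply hr
    simp only [cov, Finset.mem_filter, Finset.mem_univ, true_and]
    refine ⟨f', hf', hne.symm, ?_⟩
    rw [← heq]
    fin_cases r' <;> simp [rd3]
  have hsum : ∑ f ∈ dep7 I, (priv f).card ≤ N := by
    rw [← Finset.card_biUnion hdisj]
    exact le_trans (Finset.card_le_univ _) (by simp)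
  have h2 : (dep7 I).card * 2 ≤ N := by
    have := Finset.card_nsmul_le_sum (dep7 I) (fun f => (priv f).card) 2 hcard
    simp only [smul_eq_mul] at this
    omega
  have h3 := card_dep7_ge I
  omega

end Summit.PneNP.PneNP.Theorems.Nc03Reduction
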